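import Mathlib
import Literature.Analysis.FluidPDE.Tao2016AveragedNS.BoundedEternalSolutions
import Summits.NavierStokesRegularity.NavierStokesRegularity.Theorems.TaoLadderRungTwoBreakNoSurvivingEternalViscBddOneWakeDyadicDSSExactEnergy

/-!
# Crux `TaoLadderRungTwoBreak.NoSurvivingEternalViscBddOne` (stmt-NavierStokesRegularity-20419) / ⟨20205⟩ `NoSurvivingDSSOne`, DYADIC
# MEMBER, DSS STRATUM: the LAG DEFECT `D_n = ∫(√κ·V_n² − 2V_nV_{n+1} + V_{n+1}²/√κ) ≥ 0` and the EXACT form of (I1) —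
# `v_n = (Λ − κ√κ/Λ)·∫V_{n-1}² + D_n/(2Λ)` — with the refined overshoot floor `sup V_n · (v_n − D_n/(2Λ)) ≥ v_n²(Λ²−κ√κ)/(2(Λ²−κ²))`

MODEL lattice ODEs only (non-negative period-one DSS solutions `V_{k+1}(t) = κV_k(κt)`, `0 < κ < Λ`, of the Katz–Pavlović chain in Tao's
critical variables); nothing in this file is a statement about the Navier–Stokes equations, and no stub, crux, rung or summit is proved by it
(`--supports stmt-NavierStokesRegularity-20419`).  DEF-FREE (the defect enters as an explicit integral).

WHY.  The hand's overshoot floor (`…DSSOvershootFloor`) used AM–GM `∫V_nV_{n+1} ≤ √κ∫V_n²`; the slack in that step is EXACTLY the quantity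
that selects Kolmogorov in the memo's leading-order analysis (the «lag deficit» `Φ`): the pointwise identity
`√κ·a² + b²/√κ − 2ab = (√κ·a − b)²/√κ ≥ 0` integrates, with the DSS feed scaling `∫V_{n+1}² = κ∫V_n²`, to

  `∫V_nV_{n+1} = √κ·∫V_n² − D_n/2`,   `D_n := ∫_{(−∞,0)} (√κ·V_n² − 2V_nV_{n+1} + V_{n+1}²/√κ) ≥ 0`   (`lagDefect_nonneg`, `drain_eq`),

so the lifetime identity (I1) `v_n = Λ∫V_{n-1}² − Λ⁻¹∫V_nV_{n+1}` becomes EXACT in the feed alone: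

  **`terminal_eq_feed_add_defect`**:  `v_n = (Λ − κ√κ/Λ)·∫V_{n-1}² + D_n/(2Λ)`.

`D_n = 0` iff `V_{n+1} = √κ·V_n` a.e., i.e. (with `V_{n+1}(t) = κV_n(κt)`) iff the profile is the power law `ψ(u) ∝ u^{-1/2}` — inadmissible
(infinite action); a front is the more Kolmogorov the larger its lag defect.  Consequences:
* `refined_overshoot_floor` — for every bound `S ≥ V_n` on `t < 0`: `S·(v_n − D_n/(2Λ)) ≥ v_n²·(Λ² − κ√κ)/(2(Λ² − κ²))` (the floor of
  `…DSSOvershootFloor` is the case `D_n ≥ 0` dropped);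
* **`lagDefect_le`** — hence `D_n ≤ 2Λ·v_n·(1 − (v_n/S)·(Λ² − κ√κ)/(2(Λ² − κ²)))`: A SHELL WHOSE OVERSHOOT RATIO `S/v_n` IS CLOSE TO THE FLOOR HAS A
  SMALL LAG DEFECT; in particular (floor factor `> 1` beyond the (S₁) threshold, `…DSSOvershootFloor.one_lt_overshootFactor`) an (S₁)-survivor
  with overshoot ratio `1+Ω` has `D_n ≤ 2Λv_n(1 − floor/(1+Ω))` — its consecutive shells are nearly proportional in `L²`, the diffuse
  power-law signature of the memo's threshold analysis, now as a kernel inequality.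

HONEST LABEL: elementary consequences of the hand's identity files; W1-dyadic, (ρ0), ⟨20419⟩, ⟨20205⟩ and every NS statement remain OPEN;
rung 0.
-/

-- the summit and its single sub-problem share the name (CONVENTIONS §1)
set_option linter.dupNamespace false

namespace Summit.NavierStokesRegularity.NavierStokesRegularity.Theorems.NoSurvivingEternalViscBddOne.DSSLagDefect

open Filter Topology Set MeasureTheory Finset
open Literature.Analysis.FluidPDE.TaoCascade
open Summit.NavierStokesRegularity.NavierStokesRegularity.Theorems.NoSurvivingEternalViscBddOne

variable {ε₀ κ : ℝ} {V : ℤ → ℝ → ℝ} {v : ℤ → ℝ} {P : ℤ → ℝ → ℝ}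

/-! ## The lag defect -/

/-- Pointwise: `√κ·a² − 2ab + b²/√κ = (√κ·a − b)²/√κ ≥ 0`. [folklore] -/
theorem lagDefect_integrand_nonneg (hκ : 0 < κ) (a b : ℝ) :
    0 ≤ Real.sqrt κ * a ^ 2 - 2 * (a * b) + (Real.sqrt κ)⁻¹ * b ^ 2 := by
  have hs : 0 < Real.sqrt κ := Real.sqrt_pos.2 hκ
  have e : Real.sqrt κ * a ^ 2 - 2 * (a * b) + (Real.sqrt κ)⁻¹ * b ^ 2 = (Real.sqrt κ * a - b) ^ 2 / Real.sqrt κ := by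
    field_simp
    ring
  rw [e]; positivity

/-- **The lag defect is non-negative**: `0 ≤ D_n = ∫_{(−∞,0)} (√κ·V_n² − 2V_nV_{n+1} + V_{n+1}²/√κ)`. [elementary] -/
theorem lagDefect_nonneg (hκ : 0 < κ) (n : ℤ) :
    0 ≤ ∫ t in Iio 0, (Real.sqrt κ * V n t ^ 2 - 2 * (V n t * V (n + 1) t) + (Real.sqrt κ)⁻¹ * V (n + 1) t ^ 2) :=
  setIntegral_nonneg measurableSet_Iio fun _ _ => lagDefect_integrand_nonneg hκ _ _

/-- **The drain in terms of the feed and the defect**: on a DSS front, `∫V_nV_{n+1} = √κ·∫V_n² − D_n/2`.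
[cite: Tao2016AveragedNS, §4 Lemma 4.1 (4.8), §6.4; elementary] -/
theorem drain_eq (hκ : 0 < κ)
    (hdss : ∀ (n : ℤ) (t : ℝ), t < 0 → V (n + 1) t = κ * V n (κ * t))
    (hsq : ∀ k : ℤ, IntegrableOn (fun t => V k t ^ 2) (Iio 0))
    (hdr : ∀ k : ℤ, IntegrableOn (fun t => V k t * V (k + 1) t) (Iio 0)) (n : ℤ) :
    ∫ t in Iio 0, V n t * V (n + 1) t
      = Real.sqrt κ * (∫ t in Iio 0, V n t ^ 2)
        - (∫ t in Iio 0, (Real.sqrt κ * V n t ^ 2 - 2 * (V n t * V (n + 1) t) + (Real.sqrt κ)⁻¹ * V (n + 1) t ^ 2)) / 2 := by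
  have hs : 0 < Real.sqrt κ := Real.sqrt_pos.2 hκ
  have hss : Real.sqrt κ * Real.sqrt κ = κ := Real.mul_self_sqrt hκ.le
  have h1 : IntegrableOn (fun t => Real.sqrt κ * V n t ^ 2) (Iio 0) := (hsq n).const_mul _
  have h2 : IntegrableOn (fun t => 2 * (V n t * V (n + 1) t)) (Iio 0) := (hdr n).const_mul _
  have h3 : IntegrableOn (fun t => (Real.sqrt κ)⁻¹ * V (n + 1) t ^ 2) (Iio 0) := (hsq (n + 1)).const_mul _
  have h12 : IntegrableOn (fun t => Real.sqrt κ * V n t ^ 2 - 2 * (V n t * V (n + 1) t)) (Iio 0) := h1.sub h2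
  have hD : ∫ t in Iio 0, (Real.sqrt κ * V n t ^ 2 - 2 * (V n t * V (n + 1) t) + (Real.sqrt κ)⁻¹ * V (n + 1) t ^ 2)
      = Real.sqrt κ * (∫ t in Iio 0, V n t ^ 2) - 2 * (∫ t in Iio 0, V n t * V (n + 1) t)
        + (Real.sqrt κ)⁻¹ * (∫ t in Iio 0, V (n + 1) t ^ 2) := by
    rw [integral_add h12 h3, integral_sub h1 h2, integral_const_mul, integral_const_mul, integral_const_mul]
  have hk : (Real.sqrt κ)⁻¹ * κ = Real.sqrt κ := by
    rw [inv_mul_eq_div, div_eq_iff hs.ne']; exact hss.symm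
  rw [hD, DSSOvershootFloor.integral_sq_dss hκ hdss n, ← mul_assoc, hk]
  ring

/-! ## The exact lifetime identity -/

/-- **EXACT LIFETIME IDENTITY WITH THE LAG DEFECT**: on a non-negative DSS front born at rest with lifetime-integrable feeds and drains,
`v_n = (Λ − κ√κ/Λ)·∫_{(−∞,0)}V_{n-1}² + D_n/(2Λ)`.
[cite: Tao2016AveragedNS, §1.2, §4 Lemma 4.1 (4.8), §6.4; elementary] -/
theorem terminal_eq_feed_add_defect (hε : 0 < ε₀) (hκ : 0 < κ)
    (hV : ∀ (n : ℤ) (t : ℝ), t < 0 →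
      HasDerivAt (V n) (bigLam ε₀ * V (n - 1) t ^ 2 - (bigLam ε₀)⁻¹ * (V n t * V (n + 1) t)) t)
    (hdss : ∀ (n : ℤ) (t : ℝ), t < 0 → V (n + 1) t = κ * V n (κ * t))
    (hv : ∀ n : ℤ, Tendsto (V n) (𝓝[<] 0) (𝓝 (v n)))
    (hpast : ∀ k : ℤ, Tendsto (V k) atBot (𝓝 0))
    (hsq : ∀ k : ℤ, IntegrableOn (fun t => V k t ^ 2) (Iic 0))
    (hdr : ∀ k : ℤ, IntegrableOn (fun t => V k t * V (k + 1) t) (Iic 0)) (n : ℤ) :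
    v n = (bigLam ε₀ - κ * Real.sqrt κ / bigLam ε₀) * (∫ t in Iio 0, V (n - 1) t ^ 2)
      + (∫ t in Iio 0, (Real.sqrt κ * V n t ^ 2 - 2 * (V n t * V (n + 1) t) + (Real.sqrt κ)⁻¹ * V (n + 1) t ^ 2))
          / (2 * bigLam ε₀) := by
  have hΛ : 0 < bigLam ε₀ := bigLam_pos (by linarith)
  have hsq' : ∀ k : ℤ, IntegrableOn (fun t => V k t ^ 2) (Iio 0) := fun k => (hsq k).mono_set Iio_subset_Iic_self
  have hdr' : ∀ k : ℤ, IntegrableOn (fun t => V k t * V (k + 1) t) (Iio 0) :=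
    fun k => (hdr k).mono_set Iio_subset_Iic_self
  have hI1 := LifetimeFeedDrain.terminal_eq_feed_sub_drain hV hv n (hpast n) (hsq (n - 1)) (hdr n)
  have hJ := drain_eq hκ hdss hsq' hdr' n
  have hIn : ∫ t in Iio 0, V n t ^ 2 = κ * ∫ t in Iio 0, V (n - 1) t ^ 2 := by
    have h := DSSOvershootFloor.integral_sq_dss hκ hdss (n - 1)
    rw [sub_add_cancel] at h
    exact h
  rw [hI1, hJ, hIn]
  field_simp; ring

/-- **The refined overshoot floor**: for every bound `S ≥ V_n` on `t < 0`,
`S·(v_n − D_n/(2Λ)) ≥ v_n²·(Λ² − κ√κ)/(2(Λ² − κ²))` (the hand's `dss_overshoot_floor` is this with `D_n ≥ 0` dropped).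
[cite: Tao2016AveragedNS, §1.2, §4 Lemma 4.1 (4.8)–(4.10), §6.4; elementary] -/
theorem refined_overshoot_floor (hε : 0 < ε₀) (hκ : 0 < κ) (hκΛ : κ < bigLam ε₀)
    (hV : ∀ (n : ℤ) (t : ℝ), t < 0 →
      HasDerivAt (V n) (bigLam ε₀ * V (n - 1) t ^ 2 - (bigLam ε₀)⁻¹ * (V n t * V (n + 1) t)) t)
    (hpos : ∀ (n : ℤ) (t : ℝ), t < 0 → 0 ≤ V n t)
    (hdss : ∀ (n : ℤ) (t : ℝ), t < 0 → V (n + 1) t = κ * V n (κ * t))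
    (hP : ∀ k t, P k t = 2 * (((bigLam ε₀ ^ k)⁻¹) ^ 2 * (bigLam ε₀)⁻¹) * (V k t ^ 2 * V (k + 1) t))
    (hv : ∀ n : ℤ, Tendsto (V n) (𝓝[<] 0) (𝓝 (v n)))
    (hpast : ∀ k : ℤ, Tendsto (V k) atBot (𝓝 0))
    (hsq : ∀ k : ℤ, IntegrableOn (fun t => V k t ^ 2) (Iic 0))
    (hdr : ∀ k : ℤ, IntegrableOn (fun t => V k t * V (k + 1) t) (Iic 0))
    (hPint : ∀ k : ℤ, IntegrableOn (P k) (Iic 0))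
    (n : ℤ) {S : ℝ} (hS : ∀ t : ℝ, t < 0 → V n t ≤ S) :
    v n ^ 2 * ((bigLam ε₀ ^ 2 - κ * Real.sqrt κ) / (2 * (bigLam ε₀ ^ 2 - κ ^ 2)))
      ≤ S * (v n - (∫ t in Iio 0, (Real.sqrt κ * V n t ^ 2 - 2 * (V n t * V (n + 1) t) + (Real.sqrt κ)⁻¹ * V (n + 1) t ^ 2))
          / (2 * bigLam ε₀)) := by
  have hΛ : 0 < bigLam ε₀ := bigLam_pos (by linarith)
  have hΛne : bigLam ε₀ ≠ 0 := hΛ.ne'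
  have hS0 : 0 ≤ S := (hpos n (-1) (by norm_num)).trans (hS (-1) (by norm_num))
  have hκ2 : κ ^ 2 < bigLam ε₀ ^ 2 := pow_lt_pow_left₀ hκΛ hκ.le two_ne_zero
  have hsqrt : Real.sqrt κ < bigLam ε₀ := by
    have hΛ1 : 1 < bigLam ε₀ := Real.one_lt_rpow (by linarith) (by norm_num)
    rw [Real.sqrt_lt' hΛ]; nlinarith
  have hgap : 0 < bigLam ε₀ ^ 2 - κ * Real.sqrt κ := by
    have : κ * Real.sqrt κ < bigLam ε₀ * bigLam ε₀ := mul_lt_mul'' hκΛ hsqrt hκ.le (Real.sqrt_nonneg κ)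
    nlinarith
  have hfac : 0 < bigLam ε₀ - κ * Real.sqrt κ / bigLam ε₀ := by
    rw [sub_pos, div_lt_iff₀ hΛ]; nlinarith
  set I := ∫ t in Iio 0, V (n - 1) t ^ 2 with hI
  set D := ∫ t in Iio 0, (Real.sqrt κ * V n t ^ 2 - 2 * (V n t * V (n + 1) t) + (Real.sqrt κ)⁻¹ * V (n + 1) t ^ 2) with hD
  -- exact feed: `I = (v − D/(2Λ)) / (Λ − κ√κ/Λ)`
  have hfeed := terminal_eq_feed_add_defect hε hκ hV hdss hv hpast hsq hdr n
  have hIeq : I = (v n - D / (2 * bigLam ε₀)) / (bigLam ε₀ - κ * Real.sqrt κ / bigLam ε₀) := by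
    rw [eq_div_iff hfac.ne']
    have : v n - D / (2 * bigLam ε₀) = (bigLam ε₀ - κ * Real.sqrt κ / bigLam ε₀) * I := by rw [hfeed]; ring
    rw [this]; ring
  -- stranded energy ≤ flux ≤ 2Λ^{-2n}Λ S I
  have h3 : (∑' j : ℕ, ((bigLam ε₀ ^ (n - 1 + 1 + j))⁻¹) ^ 2 * v (n - 1 + 1 + j) ^ 2) ≤ ∫ t in Iio 0, P (n - 1) t :=
    EnergyFluxIdentity.strandedEnergy_le_flux hε hV hpos hP hv hpast hPint (n - 1)
  simp only [sub_add_cancel] at h3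
  rw [(DSSOvershootFloor.strandedEnergy_dss_hasSum hε hκ hκΛ hdss hv n).tsum_eq] at h3
  have h2 : ∫ t in Iio 0, P (n - 1) t ≤ 2 * (((bigLam ε₀ ^ (n - 1))⁻¹) ^ 2 * (bigLam ε₀)⁻¹) * S * I :=
    DSSOvershootFloor.flux_le_sup_mul_feed hε hP hsq hPint n hS
  have hwt : 2 * (((bigLam ε₀ ^ (n - 1))⁻¹) ^ 2 * (bigLam ε₀)⁻¹) = 2 * ((bigLam ε₀ ^ n)⁻¹) ^ 2 * bigLam ε₀ := by
    rw [zpow_sub_one₀ hΛne n]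
    have : bigLam ε₀ ^ n ≠ 0 := zpow_ne_zero n hΛne
    field_simp
  rw [hwt] at h2
  have hden : 0 < 1 - κ ^ 2 / bigLam ε₀ ^ 2 := by
    rw [sub_pos, div_lt_one (pow_pos hΛ 2)]; exact hκ2
  have hw : 0 < ((bigLam ε₀ ^ n)⁻¹) ^ 2 := by positivity
  have h5 : ((bigLam ε₀ ^ n)⁻¹) ^ 2 * v n ^ 2 / (1 - κ ^ 2 / bigLam ε₀ ^ 2)
      ≤ 2 * ((bigLam ε₀ ^ n)⁻¹) ^ 2 * bigLam ε₀ * S * I := h3.trans h2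
  -- divide by `w > 0`:  `v²/(1−r) ≤ 2Λ S I`
  have h6 : v n ^ 2 / (1 - κ ^ 2 / bigLam ε₀ ^ 2) ≤ 2 * bigLam ε₀ * S * I := by
    have : ((bigLam ε₀ ^ n)⁻¹) ^ 2 * (v n ^ 2 / (1 - κ ^ 2 / bigLam ε₀ ^ 2))
        ≤ ((bigLam ε₀ ^ n)⁻¹) ^ 2 * (2 * bigLam ε₀ * S * I) := by
      rw [← mul_div_assoc]; linarith [h5]
    exact le_of_mul_le_mul_left this hw
  rw [hIeq] at h6
  -- algebra: `v²/(1−κ²/Λ²) ≤ 2ΛS(v − D/(2Λ))/(Λ − κ√κ/Λ)` ⟹ claim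
  have e1 : v n ^ 2 * ((bigLam ε₀ ^ 2 - κ * Real.sqrt κ) / (2 * (bigLam ε₀ ^ 2 - κ ^ 2)))
      = (v n ^ 2 / (1 - κ ^ 2 / bigLam ε₀ ^ 2)) * ((bigLam ε₀ - κ * Real.sqrt κ / bigLam ε₀) / (2 * bigLam ε₀)) := by
    field_simp
  have e2 : S * (v n - D / (2 * bigLam ε₀))
      = (2 * bigLam ε₀ * S * ((v n - D / (2 * bigLam ε₀)) / (bigLam ε₀ - κ * Real.sqrt κ / bigLam ε₀)))
        * ((bigLam ε₀ - κ * Real.sqrt κ / bigLam ε₀) / (2 * bigLam ε₀)) := by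
    field_simp
  rw [e1, e2]
  exact mul_le_mul_of_nonneg_right h6 (div_nonneg hfac.le (by positivity))

/-- **LAG DEFECT BOUND**: with a POSITIVE bound `S ≥ V_n` on `t < 0`,
`D_n ≤ 2Λ·(v_n − (v_n²/S)·(Λ² − κ√κ)/(2(Λ² − κ²)))` — a shell whose overshoot ratio `S/v_n` is close to the floor of
`…DSSOvershootFloor` has nearly proportional consecutive shells (`V_{n+1} ≈ √κ·V_n` in `L²`).
[cite: Tao2016AveragedNS, §1.2, §4 Lemma 4.1 (4.8)–(4.10), §6.4; elementary] -/
theorem lagDefect_le (hε : 0 < ε₀) (hκ : 0 < κ) (hκΛ : κ < bigLam ε₀)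
    (hV : ∀ (n : ℤ) (t : ℝ), t < 0 →
      HasDerivAt (V n) (bigLam ε₀ * V (n - 1) t ^ 2 - (bigLam ε₀)⁻¹ * (V n t * V (n + 1) t)) t)
    (hpos : ∀ (n : ℤ) (t : ℝ), t < 0 → 0 ≤ V n t)
    (hdss : ∀ (n : ℤ) (t : ℝ), t < 0 → V (n + 1) t = κ * V n (κ * t))
    (hP : ∀ k t, P k t = 2 * (((bigLam ε₀ ^ k)⁻¹) ^ 2 * (bigLam ε₀)⁻¹) * (V k t ^ 2 * V (k + 1) t))
    (hv : ∀ n : ℤ, Tendsto (V n) (𝓝[<] 0) (𝓝 (v n)))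
    (hpast : ∀ k : ℤ, Tendsto (V k) atBot (𝓝 0))
    (hsq : ∀ k : ℤ, IntegrableOn (fun t => V k t ^ 2) (Iic 0))
    (hdr : ∀ k : ℤ, IntegrableOn (fun t => V k t * V (k + 1) t) (Iic 0))
    (hPint : ∀ k : ℤ, IntegrableOn (P k) (Iic 0))
    (n : ℤ) {S : ℝ} (hSpos : 0 < S) (hS : ∀ t : ℝ, t < 0 → V n t ≤ S) :
    (∫ t in Iio 0, (Real.sqrt κ * V n t ^ 2 - 2 * (V n t * V (n + 1) t) + (Real.sqrt κ)⁻¹ * V (n + 1) t ^ 2))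
      ≤ 2 * bigLam ε₀ * (v n - v n ^ 2 / S * ((bigLam ε₀ ^ 2 - κ * Real.sqrt κ) / (2 * (bigLam ε₀ ^ 2 - κ ^ 2)))) := by
  have hΛ : 0 < bigLam ε₀ := bigLam_pos (by linarith)
  have h := refined_overshoot_floor hε hκ hκΛ hV hpos hdss hP hv hpast hsq hdr hPint n hS
  set D := ∫ t in Iio 0, (Real.sqrt κ * V n t ^ 2 - 2 * (V n t * V (n + 1) t) + (Real.sqrt κ)⁻¹ * V (n + 1) t ^ 2) with hD
  set f := (bigLam ε₀ ^ 2 - κ * Real.sqrt κ) / (2 * (bigLam ε₀ ^ 2 - κ ^ 2)) with hf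
  -- from `v² f ≤ S (v − D/(2Λ))`: `D/(2Λ) ≤ v − v² f / S`
  have h1 : D / (2 * bigLam ε₀) ≤ v n - v n ^ 2 * f / S := by
    have h' : v n ^ 2 * f / S ≤ v n - D / (2 * bigLam ε₀) := by
      rw [div_le_iff₀ hSpos]; linarith [h]
    linarith
  have h2 := (div_le_iff₀ (by positivity : (0 : ℝ) < 2 * bigLam ε₀)).1 h1
  calc D ≤ (v n - v n ^ 2 * f / S) * (2 * bigLam ε₀) := h2
    _ = 2 * bigLam ε₀ * (v n - v n ^ 2 / S * f) := by ring

end Summit.NavierStokesRegularity.NavierStokesRegularity.Theorems.NoSurvivingEternalViscBddOne.DSSLagDefect
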